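import Mathlib
import HarnessLib
import Summits.HubbardSuperconductivity.HubbardSuperconductivity.Theorems.KLProgrammeKLRegimeEngineTowerWtAssemblyKlEngNum4
import Summits.HubbardSuperconductivity.HubbardSuperconductivity.Theorems.KLProgrammeKLRegimeEngineTowerLevelsStepOfWeighted
import Summits.HubbardSuperconductivity.HubbardSuperconductivity.Theorems.KLProgrammeKLRegimeEngineTowerWeightedPkgOfNumW4
import Summits.HubbardSuperconductivity.HubbardSuperconductivity.Theorems.KLProgrammeKLRegimeEngineTowerWtAssemblyKlEngNum4Cut

/-!
# Route `KLProgramme` — crux K3 ENGINE (stmt-HubbardSuperconductivity-20437 `KLRegimeEngineV17F2`), ROW (b) binder #5 (E1's (E4) conjunct), cure (α) of located #25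
# «(b)-PLAIN-UV-TAIL», LINK 4e: THE WEIGHTED-ONLY PACKAGE FAMILY `hW` OF THE (b) CLOSER FROM numW4-cut AND E1's THREE d-FREE ROW FAMILIES, THE (E4) CONJUNCT STATED FOR
# THE UV-CUT ELEMENT (cell gate-hubbard-kl, seat hubbard-kl-k3c2-p2 g34; twin of ✓ `hW_of_numW4` (p4 g23, p724031); pen (R669)/(R673))

WHAT CHANGES vs `…TowerWeightedPkgOfNumW4` (everything else token-identical — E1's doors `cE UE`, the (E2) input-family two-leg cells, the (E6) input-family six-leg
cells, the package `e`, conclusion): in the hypothesis `hE` the **(E4)** conjunct — the `klScaleWt_i`-weighted PLAIN four-leg line of `𝒱_i[K_n]`, λ-class `≤ s₄·ε_i`,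
`1 ≤ i ≤ n` — is stated for the leg-rescaled element `S_ĝ 𝒱_i[K_n] := ExteriorAlgebra.map (LinearMap.mulLeft ℂ ĝ) 𝒱_i[K_n]`, `ĝ((k,σ),c) = gnScaleCutoff 4 klE0 1 |ω_k|`
(one-sector UV cut `≡ 1` for `|ω| ≤ klE0`).  WHY (located #25, ✓ p765343 / p765762 / p766222): the tree's `hubbardInteraction` conserves the INTEGER Matsubara labels, so
the uncut plain position-space quartic line of `𝒱_i` carries the bare vertex's integer-truncation tail `(|U|/24)·Θ_M`, `Θ_M ≍ (ln M)²`, and the (E4) conjunct quantified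
over all `M ≥ klEngM₃` is unsatisfiable as typed; the cut line is M-uniform, and the tower reads the four-leg rows only through the aniso-from-plain transfer whose output
is blind to the cut (✓ `…TowerImportWtCut`).  The proof is the original's on `kernelNormsWt4_all_klEng_numW4_cut` (LINK 4d).
* **`hW_of_numW4_cut (hE)`** ⊢ the `hW` family VERBATIM (the input type of `hexT_uncapped_of_weighted_e4_klEngGeo14`).
Bookkeeping only; E1's rows are HYPOTHESES with no supplier in the tree; nothing asserts them, (b), any stub of 20437, K3, U₀, the window or superconductivity.
References: BGM 2006 §2.5 (2.48), §2.8 (2.76)–(2.84), (2.77), Lemma 2.5 (2.98), §3 (3.2)–(3.8) [cite: BenfattoGiulianiMastropietro2006].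
-/

noncomputable section

namespace Summit.HubbardSuperconductivity.HubbardSuperconductivity.Theorems.EngineV8

set_option linter.dupNamespace false -- summit = problem name (single-conjunct summit), D-0017

open Classical
open Real Finset Literature.MathematicalPhysics.QuantumLattice Literature.Probability.LatticeModels GrassmannAlgebra
open Literature.MathematicalPhysics.QuantumLattice.FermiRG Literature.MathematicalPhysics.QuantumLattice.FermiRG.BGM2006Routing
open Summit.HubbardSuperconductivity.HubbardSuperconductivity.Theorems.KLProgrammeLegKernels
open Summit.HubbardSuperconductivity.HubbardSuperconductivity.Theorems.KLRegimeSplit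
open Summit.HubbardSuperconductivity.HubbardSuperconductivity.Theorems.KLRegimeWick
open Summit.HubbardSuperconductivity.HubbardSuperconductivity.Theorems.TwoPointAssembly
open Summit.HubbardSuperconductivity.HubbardSuperconductivity.Theorems.DispersionFlow
open Summit.HubbardSuperconductivity.HubbardSuperconductivity.Theorems.TorusFourierL2

/-- **`hW` FROM numW4-cut AND E1's ROWS, THE (E4) CONJUNCT UV-CUT** — the weighted-only package family of `hexT_uncapped_of_weighted_e4_klEngGeo14` from `kernelNormsWt4_all_klEng_numW4` and
the d-free E1 family `hE` = (E2) input-family two-leg cells (c-class) ∧ (E4) plain four-leg line at its own rate (λ-class) ∧ (E6) input-family six-leg cells, under E1's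
OWN doors `cc ≤ cE`, `U ≤ UE` (p3 g23's «hE-DOOR-SLOT»: the thin-count doors are not dominated by the engine's); see the module docstring. [cite: BenfattoGiulianiMastropietro2006, §2.8 (2.76)-(2.84), (2.77), Lemma 2.5 (2.98), §3 (3.2)-(3.8)] -/
theorem hW_of_numW4_cut
    (hE : ∀ (P : SplitConsts) (R : RenConsts), P.WF → R.WF2 →
      ∃ s₂u s₂c s₄ S₆ : ℝ, 0 ≤ s₂u ∧ 0 ≤ s₂c ∧ 0 ≤ s₄ ∧ 0 ≤ S₆ ∧ ∃ cE UE : ℝ, 0 < cE ∧ 0 < UE ∧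
      ∀ (Q : EngConsts) (cc : ℝ), 0 < cc → cc ≤ klEngC₃6 P R → cc ≤ cE →
      ∀ μ ∈ klWindowC, ∀ U : ℝ, 0 < U → U ≤ klEngU₀10 P R cc → U ≤ UE →
      ∀ β : ℝ, klBetaMin ≤ β → β ≤ Real.exp (cc / U ^ 2) →
      ∀ (L M : ℕ) [NeZero L] [NeZero M], klEngL₄ P R β U ≤ L → klEngM₃ β U L ≤ M →
      ∀ n : ℕ, 1 ≤ n → n ≤ nScales β + 1 → IsKLRegime U cc (-(n : ℤ)) →
      HistP klPredsV17F2 L M klEngGeo14 P Q R β U μ 0 n →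
      (∀ m, 1 ≤ m → m < n → FlowPieceOscAt L M (klReadOscC P R) β U μ m) →
      FrameOK R U (nScales β) μ (klFlowFrameU L M β U μ n) →
      (∀ j ≤ n, LevelsUExportMixedAt L M (klCU2 P R (klEngQ7 P R)) P β U μ j) →
      (∀ i, 1 ≤ i → i ≤ n → ∀ (q : Fin 2) (w : SpaceTimeIdx L M × SectorLeg (sectorCount (i - 1))),
        klWtPinnedSumOf L M β μ (klFlowFrameU L M β U μ n) (i - 1) 2 (klEffectiveAction L M β U μ (klFlowFrameU L M β U μ n) klE0 i) q w ≤
          (s₂u * |U| + s₂c * cc) * ((4 : ℝ) ^ (i - 1))⁻¹) ∧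
      (∀ i, 1 ≤ i → i ≤ n → ∀ (q : Fin 4) (τ' : Fin 4 → SectorLeg 1) (y' : SpaceTimeIdx L M),
        imagTimeWeight β M ^ 3 * ∑ x' ∈ univ.filter (fun x' : Fin 4 → SpaceTimeIdx L M => x' q = y'),
          klScaleWt L M β i ((univ.image x').image (fun x : SpaceTimeIdx L M => (((((2 * (x.1 : ℕ) : ℕ)) : ZMod (2 * (2 * M)))), x.2))) *
            ‖sectorisedKernel L M β (trivialMultiplier L M)
              (ExteriorAlgebra.map (LinearMap.mulLeft ℂ (fun K : HubbardFieldIdx L M => ((gnScaleCutoff 4 klE0 1 |matsubaraFreq β M K.1.1.1| : ℝ) : ℂ))) (klEffectiveAction L M β U μ (klFlowFrameU L M β U μ n) klE0 i)) 4 τ' x'‖ ≤ s₄ * epsCoupling P U i) ∧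
      (∀ i, 1 ≤ i → i ≤ n → ∀ (q : Fin 6) (w : SpaceTimeIdx L M × SectorLeg (sectorCount (i - 1))),
        klWtPinnedSumOf L M β μ (klFlowFrameU L M β U μ n) (i - 1) 6 (klEffectiveAction L M β U μ (klFlowFrameU L M β U μ n) klE0 i) q w ≤
          S₆ * epsCoupling P U i ^ 2 * (2 : ℝ) ^ (4 * i))) :
    ∀ (P : SplitConsts) (R : RenConsts), P.WF → R.WF2 → ∃ e : ℝ × (EngConsts → ℝ → ℝ) × ℝ, IsTowerPkgC e ∧
      ∀ Q : EngConsts, (klEngQ8 P R).IsRaiseOf Q → e.1 ≤ Q.CE →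
      ∀ cc : ℝ, 0 < cc → cc ≤ klEngC₃6 P R → cc ≤ e.2.2 →
      ∀ μ ∈ klWindowC, ∀ U : ℝ, 0 < U → U ≤ klEngU₀10 P R cc → U ≤ e.2.1 Q cc →
      ∀ β : ℝ, klBetaMin ≤ β → β ≤ Real.exp (cc / U ^ 2) →
      ∀ (L M : ℕ) [NeZero L] [NeZero M], klEngL₄ P R β U ≤ L → klEngM₃ β U L ≤ M →
      ∀ n : ℕ, 1 ≤ n → n ≤ nScales β + 1 → IsKLRegime U cc (-(n : ℤ)) →
      HistP klPredsV17F2 L M klEngGeo14 P Q R β U μ 0 n →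
      (∀ m, 1 ≤ m → m < n → FlowPieceOscAt L M (klReadOscC P R) β U μ m) →
      FrameOK R U (nScales β) μ (klFlowFrameU L M β U μ n) →
      (∀ j ≤ n, LevelsUExportMixedAt L M (klCU2 P R (klEngQ7 P R)) P β U μ j) →
      ∀ j : ℕ, 1 ≤ j → j ≤ n → KernelNormsWt4 L M (klWtBudget P Q U j) β U μ (klFlowFrameU L M β U μ n) j := by
  intro P R hP hR
  have hK0 : 0 ≤ klReadOscC P R := klReadOscC_nonneg P R
  have hc'' : 0 < klReadOscC P R + 1 := by linarith
  obtain ⟨d₀, hd₀2, hall⟩ := kernelNormsWt4_all_klEng_numW4_cut R (klReadOscC P R + 1) hc''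
  obtain ⟨CW₄, hCW₄, hall1⟩ := hall d₀ le_rfl
  obtain ⟨c₃', hc₃', U₀', hU₀', hall2⟩ := hall1 hR
  obtain ⟨c₀, hc₀, U₁, hU₁, hall3⟩ := hall2 P hP
  obtain ⟨s₂u, s₂c, s₄, S₆, hs₂u, hs₂c, hs₄, hS₆, cE, UE, hcE, hUE, hErows⟩ := hE P R hP hR
  obtain ⟨Bf, uf, CEf, ug, s₂m, hBf1, huf, hCEf, hug, hs₂m, hmain⟩ := hall3 s₄ S₆ s₄ hs₄ hS₆ hs₄
  have hKlam : 0 < P.Klam := lt_of_lt_of_le one_pos hP.1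
  have hBf0 : 0 < Bf := lt_of_lt_of_le one_pos hBf1
  -- the package: `e.1 := CEf`, the U-threshold and the c-threshold as minima of numW4's doors and the two-leg c-class doors
  obtain ⟨uU, huU⟩ : ∃ x : ℝ, x = min U₀' (min U₁ (min (1 / (klReadOscC P R + 1)) (min (uf / (2 * Bf * P.Klam + 1))
    (min (1 / ((d₀ : ℝ) + 1)) (min ug (min UE (s₂m / (2 * s₂u + 1)))))))) := ⟨_, rfl⟩
  obtain ⟨cT, hcT⟩ : ∃ x : ℝ, x = min c₃' (min c₀ (min ug (min (uf * Real.log 4 / (2 * Bf * P.Klam + 1)) (min cE (s₂m / (2 * s₂c + 1)))))) :=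
    ⟨_, rfl⟩
  have hlog4 : 0 < Real.log 4 := Real.log_pos (by norm_num)
  have huU0 : 0 < uU := by
    rw [huU]; exact lt_min hU₀' (lt_min hU₁ (lt_min (by positivity) (lt_min (by positivity) (lt_min (by positivity) (lt_min hug (lt_min hUE (by positivity)))))))
  have hcT0 : 0 < cT := by rw [hcT]; exact lt_min hc₃' (lt_min hc₀ (lt_min hug (lt_min (by positivity) (lt_min hcE (by positivity)))))
  refine ⟨(CEf, fun _ _ => uU, cT), ⟨hCEf, fun _ _ => huU0, hcT0⟩, ?_⟩
  intro Q hQ hCE cc hcc hcc6 hccT μ hμ U hU hU10 hUu β hβ hβc L M _ _ hL hM n hn1 hn hreg hhist hosc hfr hlevU j hj1 hj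
  simp only at hCE hccT hUu
  -- the doors
  rw [hcT] at hccT; simp only [le_min_iff] at hccT
  obtain ⟨hcc₃', hcc₀, hcug, hccuf, hccE, hccs⟩ := hccT
  rw [huU] at hUu; simp only [le_min_iff] at hUu
  obtain ⟨hUU₀', hUU₁, hUosc, hUuf, hUd, hUug, hUUE, hUs⟩ := hUu
  have hcU : (klReadOscC P R + 1) * U ≤ 1 := by rw [mul_comm]; exact (le_div_iff₀ hc'').1 hUosc
  have hβ0 : 0 < β := KLRegimeSplit.pos_of_klBetaMin_le hβ
  -- the two-leg c-class amplitude under the numerics' threshold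
  have hS₂m : s₂u * |U| + s₂c * cc ≤ s₂m := by
    rw [abs_of_pos hU]
    have h1 : s₂u * U ≤ s₂m / 2 := by
      refine (mul_le_mul_of_nonneg_left hUs hs₂u).trans ?_
      rw [show s₂u * (s₂m / (2 * s₂u + 1)) = s₂m / 2 * (2 * s₂u / (2 * s₂u + 1)) by ring]
      exact (mul_le_mul_of_nonneg_left ((div_le_one (by positivity)).2 (by linarith)) (by positivity)).trans (le_of_eq (mul_one _))
    have h2 : s₂c * cc ≤ s₂m / 2 := by
      refine (mul_le_mul_of_nonneg_left hccs hs₂c).trans ?_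
      rw [show s₂c * (s₂m / (2 * s₂c + 1)) = s₂m / 2 * (2 * s₂c / (2 * s₂c + 1)) by ring]
      exact (mul_le_mul_of_nonneg_left ((div_le_one (by positivity)).2 (by linarith)) (by positivity)).trans (le_of_eq (mul_one _))
    linarith
  have hS₂0 : 0 ≤ s₂u * |U| + s₂c * cc := by positivity
  obtain ⟨hE2, hE4, hE6⟩ := hErows Q cc hcc hcc6 hccE μ hμ U hU hU10 hUUE β hβ hβc L M hL hM n hn1 hn hreg hhist hosc hfr hlevU
  -- E1's rows in numW4's shapes
  have hεmono : ∀ a b : ℕ, a ≤ b → epsCoupling P U a ≤ epsCoupling P U b := by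
    intro a b hab; unfold epsCoupling; have : (a : ℝ) ≤ (b : ℝ) := Nat.cast_le.2 hab; gcongr
  have hε0 : ∀ a : ℕ, 0 ≤ epsCoupling P U a := fun a => by unfold epsCoupling; positivity
  refine hmain klEngGeo14 Q cc hcc hcc6 hcc₃' hcc₀ hcug μ hμ U hU (hU10.trans (klEngU₀10_le_klEngU₀9 P R cc)) hUU₀' hUU₁ hcU hUuf hUd hUug
    β hβ hβc L M (klEngL₃_le_of_klEngL₄_le hL) hM n hn1 hn hreg hhist (fun m hm1 hmn => (hosc m hm1 hmn).mono (by linarith)) hccuf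
    (s₂u * |U| + s₂c * cc) hS₂0 hS₂m (fun j' _ hjn k hk hkj q w => hE2 (d₀ * k) (Nat.mul_pos (by omega) hk) (by omega) q w) ?_
    (fun j' _ hjn q w => hE6 j' (by omega) hjn q w) Q hCE ((isRaiseOf_klEngQ8 P R).trans hQ) (fun j' hj1' hjn q τ' y' => hE4 j' hj1' hjn q τ' y') j hj
  -- the plain four-leg import rows of the blocks: the own-rate line at `i = d₀·k`, rate weakened to `j' ≥ d₀·k`, `ε_{d₀k} ≤ Bf·ε_{j'}`
  intro j' _ hjn k hk hkj q τ' y'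
  have h1 := hE4 (d₀ * k) (Nat.mul_pos (by omega) hk) (by omega) q τ' y'
  have hεj : s₄ * epsCoupling P U (d₀ * k) ≤ s₄ * (Bf * epsCoupling P U j') :=
    mul_le_mul_of_nonneg_left ((hεmono _ _ hkj).trans (le_mul_of_one_le_left (hε0 j') hBf1)) hs₄
  refine le_trans ?_ (h1.trans hεj)
  have hεx : 0 ≤ imagTimeWeight β M := imagTimeWeight_nonneg hβ0.le M
  unfold klTowerInput
  gcongr with x' hx'
  exact klScaleWt_le_of_le β hkj _

end Summit.HubbardSuperconductivity.HubbardSuperconductivity.Theorems.EngineV8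

end
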